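import Summits.BirchSwinnertonDyer.BirchSwinnertonDyer.Theorems.CycTangentCMCycTangentBoundPairSupply
import Summits.BirchSwinnertonDyer.Rank1Residual.X11b.InterpolationCharacterSupply
import Literature.NumberTheory.EllipticCurves.DeShalit1987.KatzPAdicLFunctionFunctionalEquation
import Literature.NumberTheory.EllipticCurves.IntSeriesIdentityPrinciple
import Literature.NumberTheory.EllipticCurves.Rubin1991.TwoVariableCMLines
import Literature.NumberTheory.EllipticCurves.CyclotomicZpExtension
import Literature.NumberTheory.EllipticCurves.ZpExtensionProofs
import Literature.NumberTheory.GaloisRepresentations.AbsGaloisOuterConj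
import HarnessLib

set_option linter.dupNamespace false
set_option autoImplicit false

/-!
# Crux `CycTangentCM.CycTangentBound` (stmt-BirchSwinnertonDyer-22628), stub `stub_selfDual`:
# POWER CHARACTERS THROUGH A `ℤ_p`-QUOTIENT AND CONJUGATE-INVERSE PARTNERS (plumbing for the sign lemma)

Seat `bsd-line-ctcm-p2` (line `tangent-cone-parity`, lead `bsd-line-ctcm-p1`). Plumbing for
`CycTangentCMCycTangentBoundSignLemma` (the constant of a self-dual functional equation is `±1`):

* §1 `exists_powChar` — for every `ℤ_p`-quotient `κ : Γ_K ↠ ℤ_p` the continuous character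
  `σ ↦ γ_cyc^{κ(σ)} ∈ ℚ̄_pˣ` (`γ_cyc = 1 + p^{e₀}`, the tree's `CyclotomicZp.cycPow`; Serre's
  `θ_α : z ↦ α^z`), killing `ker κ`; its values are principal units `γ_cyc^z`, `‖γ_cyc^z − 1‖ = ‖z‖·‖p^{e₀}‖`.
* §2 `isConjInverse_symm`, `isConjInverse_comp_outerConj_inv`, `factorsThroughPair_comp_outerConj_inv` —
  `IsConjInverse` is symmetric; the conjugate-inverse partner of a character `χ` through a generator
  pair is `(χ ∘ θ_c)⁻¹` (`θ_c = absGaloisOuterConj ℚ K c`, `c` a complex conjugation), again through the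
  pair (the pair kernel is `θ_c`-stable: it is killed by every `ℤ_p`-character, p584708).
* §3 `exists_hasValueAt₂`, `hasValueAt₂_zero_iff` — values on the open polydisc.

THEOREMS ONLY (no `def`, no fact, no `sorry`); supports, does not close, stmt-BirchSwinnertonDyer-22628.
BSD is not proved by this.

References: [Serre1973] Ch. II §3.2 Prop. 8; [deShalit1987] II.6.1 (2); [NeukirchANT1999] Ch. I §9;
[Washington1997] §13.1.
-/

noncomputable section

open scoped Topology
open Filter NumberField IsDedekindDomain Field
open Literature.NumberTheory.GaloisRepresentations Literature.NumberTheory.EllipticCurves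
open Literature.NumberTheory.EllipticCurves.CyclotomicZp
open Summit.BirchSwinnertonDyer.Rank1Residual.X11b.Three.LambdaSupply
open Summit.BirchSwinnertonDyer.Rank1Residual.X11b.LambdaSupply

namespace Summit.BirchSwinnertonDyer.BirchSwinnertonDyer.Theorems.CycTangentCMCycTangentBoundPowerCharacters

variable {K : Type} [Field K] [NumberField K] {p : ℕ} [Fact p.Prime]

/-! ### §1. The power character `σ ↦ γ_cyc^{κ(σ)}` through a `ℤ_p`-quotient -/

/-- `‖γ_cyc^z‖ = 1` read in `ℂ_p`. [cite: Serre1973, Ch. II §3.2 Prop. 8] -/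
theorem norm_coe_cycPow (z : ℤ_[p]) : ‖(((cycPow p z : ℤ_[p]) : ℚ_[p]) : ℂ_[p])‖ = 1 := by
  rw [PadicComplex.norm_extends', ← PadicInt.norm_def]
  exact norm_cycPow p z

/-- `‖γ_cyc^z − 1‖ = ‖z‖·‖p^{e₀}‖ < 1` read in `ℂ_p`. [cite: Serre1973, Ch. II §3.2 Prop. 8] -/
theorem norm_coe_cycPow_sub_one (z : ℤ_[p]) :
    ‖(((cycPow p z : ℤ_[p]) : ℚ_[p]) : ℂ_[p]) - 1‖ = ‖z‖ * ‖((p : ℤ_[p]) ^ cyclotomicExponent p)‖ := by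
  have h1 : (((cycPow p z : ℤ_[p]) : ℚ_[p]) : ℂ_[p]) - 1 = (((cycPow p z - 1 : ℤ_[p]) : ℚ_[p]) : ℂ_[p]) := by
    push_cast; ring
  rw [h1, PadicComplex.norm_extends', ← PadicInt.norm_def, cycPow,
    PadicOneUnits.norm_oneAddPow_sub_one _ (cyclotomicExponent_cond p), ← cyclotomicExponent_eq_succ]

/-- `‖γ_cyc^z − 1‖ < 1` read in `ℂ_p`. [cite: Serre1973, Ch. II §3.2 Prop. 8] -/
theorem norm_coe_cycPow_sub_one_lt (z : ℤ_[p]) : ‖(((cycPow p z : ℤ_[p]) : ℚ_[p]) : ℂ_[p]) - 1‖ < 1 := by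
  rw [norm_coe_cycPow_sub_one]
  have hq : ‖((p : ℤ_[p]) ^ cyclotomicExponent p)‖ < 1 := by
    rw [cyclotomicExponent_eq_succ]; exact PadicOneUnits.norm_p_pow_succ_lt_one p _
  exact mul_lt_one_of_nonneg_of_lt_one_right (PadicInt.norm_le_one z) (norm_nonneg _) hq

/-- `z ↦ γ_cyc^z ∈ ℂ_p` is continuous. [cite: Serre1973, Ch. II §3.2 Prop. 8] -/
theorem continuous_coe_cycPow : Continuous fun z : ℤ_[p] ↦ (((cycPow p z : ℤ_[p]) : ℚ_[p]) : ℂ_[p]) :=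
  ((UniformSpace.Completion.continuous_coe (PadicAlgCl p)).comp
    (continuous_algebraMap ℚ_[p] (PadicAlgCl p))).comp
    (continuous_subtype_val.comp (PadicOneUnits.continuous_oneAddPow (p := p) _))

/-- `γ_cyc^{−z} · γ_cyc^{z} = 1` in `ℂ_p`. [cite: Serre1973, Ch. II §3.2 Prop. 8] -/
theorem coe_cycPow_neg_mul (z : ℤ_[p]) :
    (((cycPow p (-z) : ℤ_[p]) : ℚ_[p]) : ℂ_[p]) * (((cycPow p z : ℤ_[p]) : ℚ_[p]) : ℂ_[p]) = 1 := by
  have h : cycPow p (-z) * cycPow p z = 1 := by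
    rw [← AddChar.map_add_eq_mul, neg_add_cancel, AddChar.map_zero_eq_one]
  have h1 : ((cycPow p (-z) : ℤ_[p]) : ℚ_[p]) * ((cycPow p z : ℤ_[p]) : ℚ_[p]) = 1 := by
    rw [← PadicInt.coe_mul, h, PadicInt.coe_one]
  have h2 : (((cycPow p (-z) : ℤ_[p]) : ℚ_[p]) : PadicAlgCl p) * (((cycPow p z : ℤ_[p]) : ℚ_[p]) : PadicAlgCl p)
      = 1 := by
    rw [← map_mul, h1, map_one]
  rw [← UniformSpace.Completion.coe_mul, h2, UniformSpace.Completion.coe_one]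

/-- `(γ_cyc^z)⁻¹ = γ_cyc^{−z}` on units of `ℤ_p`. [cite: Serre1973, Ch. II §3.2 Prop. 8] -/
theorem val_inv_cycPowUnit (z : ℤ_[p]) : (((cycPowUnit p z)⁻¹ : ℤ_[p]ˣ) : ℤ_[p]) = cycPow p (-z) := by
  have h : cycPowUnit p (-z) * cycPowUnit p z = 1 := Units.ext (by
    rw [Units.val_mul, val_cycPowUnit, val_cycPowUnit, ← AddChar.map_add_eq_mul, neg_add_cancel,
      AddChar.map_zero_eq_one, Units.val_one])
  rw [← eq_inv_of_mul_eq_one_left h, val_cycPowUnit]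

/-- `z ↦ γ_cyc^z` is continuous into the units `ℤ_pˣ`. [cite: Serre1973, Ch. II §3.2 Prop. 8] -/
theorem continuous_cycPowUnit : Continuous fun z : ℤ_[p] ↦ cycPowUnit p z := by
  have h1 : Continuous fun z : ℤ_[p] ↦ cycPow p z := PadicOneUnits.continuous_oneAddPow (p := p) _
  refine Units.continuous_iff.mpr ⟨h1, ?_⟩
  have : (fun z : ℤ_[p] ↦ (((cycPowUnit p z)⁻¹ : ℤ_[p]ˣ) : ℤ_[p])) = fun z ↦ cycPow p (-z) :=
    funext fun z ↦ val_inv_cycPowUnit z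
  rw [this]
  exact h1.comp continuous_neg

omit [NumberField K] in
/-- **The power character through a `ℤ_p`-quotient.** For every `κ : Γ_K ↠ ℤ_p` there is a continuous
character `χ : Γ_K → ℚ̄_pˣ` with `χ(σ) = γ_cyc^{κ(σ)}` (`γ_cyc = 1 + p^{e₀}`, Serre's `θ_α : z ↦ α^z`);
it kills `ker κ`. [cite: Serre1973, Ch. II §3.2 Prop. 8] [cite: Washington1997, §13.1] -/
theorem exists_powChar (κ : ZpExtension K p) :
    ∃ χ : absoluteGaloisGroup K →ₜ* (PadicAlgCl p)ˣ,
      (∀ σ, κ σ = 1 → χ σ = 1) ∧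
      ∀ σ, (((χ σ : (PadicAlgCl p)ˣ) : PadicAlgCl p) : ℂ_[p]) =
        (((cycPow p (Multiplicative.toAdd (κ σ)) : ℤ_[p]) : ℚ_[p]) : ℂ_[p]) := by
  let ι : ℤ_[p]ˣ →* (PadicAlgCl p)ˣ :=
    Units.map (((algebraMap ℚ_[p] (PadicAlgCl p)).comp PadicInt.Coe.ringHom : ℤ_[p] →+* PadicAlgCl p) :
      ℤ_[p] →* PadicAlgCl p)
  have hιc : Continuous ι :=
    Continuous.units_map _ ((continuous_algebraMap ℚ_[p] (PadicAlgCl p)).comp continuous_subtype_val)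
  let f : absoluteGaloisGroup K →* (PadicAlgCl p)ˣ :=
    { toFun := fun σ ↦ ι (cycPowUnit p (Multiplicative.toAdd (κ σ)))
      map_one' := by
        have : cycPowUnit p (Multiplicative.toAdd (κ 1)) = 1 := Units.ext (by
          rw [val_cycPowUnit, map_one, toAdd_one, AddChar.map_zero_eq_one, Units.val_one])
        rw [this, map_one]
      map_mul' := fun σ τ ↦ by
        have : cycPowUnit p (Multiplicative.toAdd (κ (σ * τ))) =
            cycPowUnit p (Multiplicative.toAdd (κ σ)) * cycPowUnit p (Multiplicative.toAdd (κ τ)) :=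
          Units.ext (by rw [Units.val_mul, val_cycPowUnit, val_cycPowUnit, val_cycPowUnit, map_mul,
            toAdd_mul, AddChar.map_add_eq_mul])
        rw [this, map_mul] }
  have hfc : Continuous f :=
    hιc.comp (continuous_cycPowUnit.comp (continuous_toAdd.comp (map_continuous κ)))
  refine ⟨⟨f, hfc⟩, fun σ hσ ↦ ?_, fun σ ↦ ?_⟩
  · change ι (cycPowUnit p (Multiplicative.toAdd (κ σ))) = 1
    have : cycPowUnit p (Multiplicative.toAdd (κ σ)) = 1 := Units.ext (by
      rw [val_cycPowUnit, hσ, toAdd_one, AddChar.map_zero_eq_one, Units.val_one])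
    rw [this, map_one]
  · change ((((ι (cycPowUnit p (Multiplicative.toAdd (κ σ))) : (PadicAlgCl p)ˣ) : PadicAlgCl p)) : ℂ_[p]) = _
    rfl

/-! ### §2. Conjugate-inverse partners through the pair -/

/-- **`IsConjInverse` is symmetric.** [cite: deShalit1987, II.6.1 (2) (store chunk 81)] -/
theorem isConjInverse_symm {r r₂ : FramedGaloisRep K (PadicAlgCl p) 1} (h : IsConjInverse r r₂) :
    IsConjInverse r₂ r := by
  intro σ τ c hc hτ
  have hc' : c⁻¹ ∉ Set.range (absGaloisRestrict ℚ K) := fun ⟨x, hx⟩ ↦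
    hc ⟨x⁻¹, by rw [map_inv, hx, inv_inv]⟩
  have hσ : absGaloisRestrict ℚ K σ = c⁻¹ * absGaloisRestrict ℚ K τ * c⁻¹⁻¹ := by
    rw [hτ, inv_inv]; group
  rw [h τ σ c⁻¹ hc' hσ, inv_inv]

/-- **The conjugate-inverse partner of a character `χ` is `(χ ∘ θ_c)⁻¹`**, `θ_c` the outer action on
`Γ_K` of any `c ∈ Γ_ℚ ∖ res(Γ_K)` (`K` quadratic): for `res τ = c'·res σ·c'⁻¹` with `c' ∉ res(Γ_K)`,
`θ_c τ = kσk⁻¹` with `res k = c c' ∈ res(Γ_K)` (index two), and `χ` is abelian-valued.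
[cite: deShalit1987, II.6.1 (2) (store chunk 81)] [cite: NeukirchANT1999, Ch. I §9] -/
theorem isConjInverse_comp_outerConj_inv [IsGalois ℚ K] (hK2 : Module.finrank ℚ K = 2)
    {c : absoluteGaloisGroup ℚ} (hc : c ∉ Set.range (absGaloisRestrict ℚ K))
    (χ : absoluteGaloisGroup K →ₜ* (PadicAlgCl p)ˣ) :
    IsConjInverse ((FramedRep.unitsContinuousMulEquivOfUnique (Fin 1) (PadicAlgCl p) : (PadicAlgCl p)ˣ →ₜ* GL (Fin 1) (PadicAlgCl p)).comp χ) ((FramedRep.unitsContinuousMulEquivOfUnique (Fin 1) (PadicAlgCl p) : (PadicAlgCl p)ˣ →ₜ* GL (Fin 1) (PadicAlgCl p)).comp ((χ.comp (absGaloisOuterConj ℚ K c))⁻¹)) := by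
  intro σ τ c' hc' hτ
  -- `c c' ∈ res(Γ_K)`
  have hcinv : c⁻¹ ∉ Set.range (absGaloisRestrict ℚ K) := fun ⟨x, hx⟩ ↦
    hc ⟨x⁻¹, by rw [map_inv, hx, inv_inv]⟩
  obtain ⟨k, hk⟩ : c * c' ∈ Set.range (absGaloisRestrict ℚ K) := by
    have := inv_mul_mem_range_absGaloisRestrict hK2 hcinv hc'
    rwa [inv_inv] at this
  -- `θ_c τ = k σ k⁻¹`
  have hθ : absGaloisOuterConj ℚ K c τ = k * σ * k⁻¹ := absGaloisRestrict_injective ℚ K (by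
    rw [absGaloisRestrict_absGaloisOuterConj, hτ, map_mul, map_mul, map_inv, hk]; group)
  rw [ContinuousMonoidHom.coe_comp, Function.comp_apply, ContinuousMonoidHom.coe_comp, Function.comp_apply,
    ← map_inv]
  congr 1
  rw [unitsChar_inv_apply, ContinuousMonoidHom.coe_comp, Function.comp_apply, hθ, map_mul, map_mul,
    map_inv, mul_inv_cancel_comm]

/-- **The pair kernel is stable under the outer action**: `θ_c(pairKer) ⊆ pairKer` (`K` imaginary
quadratic: `pairKer` is killed by EVERY `ℤ_p`-character, in particular by `κ_i ∘ θ_c`). Hence the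
partner `(χ ∘ θ_c)⁻¹` of a character `χ` through the pair is again through the pair.
[cite: Washington1997, §13.1 and Thm. 13.4] -/
theorem factorsThroughPair_comp_outerConj_inv [IsGalois ℚ K] (hK : IsImaginaryQuadratic K)
    {κ₁ κ₂ : ZpExtension K p} {γ₁ γ₂ : absoluteGaloisGroup K}
    (hpair : ZpExtension.IsTopGeneratorPair κ₁ κ₂ γ₁ γ₂) (c : absoluteGaloisGroup ℚ)
    {χ : absoluteGaloisGroup K →ₜ* (PadicAlgCl p)ˣ} (hχ : FactorsThroughPair κ₁ κ₂ ((FramedRep.unitsContinuousMulEquivOfUnique (Fin 1) (PadicAlgCl p) : (PadicAlgCl p)ˣ →ₜ* GL (Fin 1) (PadicAlgCl p)).comp χ)) :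
    FactorsThroughPair κ₁ κ₂ ((FramedRep.unitsContinuousMulEquivOfUnique (Fin 1) (PadicAlgCl p) : (PadicAlgCl p)ˣ →ₜ* GL (Fin 1) (PadicAlgCl p)).comp ((χ.comp (absGaloisOuterConj ℚ K c))⁻¹)) := by
  have himag : ∀ w : InfinitePlace K, w.IsComplex := fun w ↦ hK.2.isComplex w
  intro σ h₁ h₂
  set θ := absGaloisOuterConj ℚ K c
  have h₁' : κ₁ (θ σ) = 1 := by
    have := CycTangentCMCycTangentBoundPairSupply.toAdd_eq_zero_of_isTopGeneratorPair hK.1 himag hpair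
      (κ₁.toContinuousMonoidHom.comp θ) h₁ h₂
    rwa [ContinuousMonoidHom.coe_comp, Function.comp_apply, ZpExtension.coe_toContinuousMonoidHom] at this
  have h₂' : κ₂ (θ σ) = 1 := by
    have := CycTangentCMCycTangentBoundPairSupply.toAdd_eq_zero_of_isTopGeneratorPair hK.1 himag hpair
      (κ₂.toContinuousMonoidHom.comp θ) h₁ h₂
    rwa [ContinuousMonoidHom.coe_comp, Function.comp_apply, ZpExtension.coe_toContinuousMonoidHom] at this
  have hχθ : χ (θ σ) = 1 := by
    have := hχ (θ σ) h₁' h₂'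
    rw [ContinuousMonoidHom.coe_comp, Function.comp_apply] at this
    exact (map_eq_one_iff _ (FramedRep.unitsContinuousMulEquivOfUnique (Fin 1) (PadicAlgCl p)).injective).mp this
  rw [ContinuousMonoidHom.coe_comp, Function.comp_apply, unitsChar_inv_apply, ContinuousMonoidHom.coe_comp,
    Function.comp_apply, hχθ, inv_one, map_one]

/-! ### §3. Values on the open polydisc -/

/-- A value of `G` exists at every point of the open polydisc. [cite: deShalit1987, II.4.17 (54) (p. 78)] -/
theorem exists_hasValueAt₂ (G : PowerSeries (PowerSeries (PadicComplexInt p))) {x y : ℂ_[p]}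
    (hx : ‖x‖ < 1) (hy : ‖y‖ < 1) : ∃ v, IntSeries.HasValueAt₂ G x y v :=
  ⟨_, (IntSeries.summable_coeff_mul_pow_mul_pow G hx hy).hasSum⟩

/-- The value of the zero series is zero. [cite: deShalit1987, II.4.17 (54) (p. 78)] -/
theorem hasValueAt₂_zero_iff {x y v : ℂ_[p]} :
    IntSeries.HasValueAt₂ (0 : PowerSeries (PowerSeries (PadicComplexInt p))) x y v ↔ v = 0 := by
  have h0 : IntSeries.HasValueAt₂ (0 : PowerSeries (PowerSeries (PadicComplexInt p))) x y 0 := by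
    unfold IntSeries.HasValueAt₂
    simp only [map_zero, ZeroMemClass.coe_zero, zero_mul]
    exact hasSum_zero
  exact ⟨fun h ↦ h.unique h0, fun h ↦ h ▸ h0⟩

end Summit.BirchSwinnertonDyer.BirchSwinnertonDyer.Theorems.CycTangentCMCycTangentBoundPowerCharacters

end
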